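/-
COR-CM (cell pub-hodgecm2, stage 2 of the Hodge ladder) — count-neutral KERNEL COMBINATORICS «field level of the SYLOW TRANSFER, VII: degree 8m with a
reflected / central automorphism of order m; the octic composita» (seat prover-pub-hodgecm2-b23-g57-0, binder prover b23, gen 57; own census lane
SYLOW TRANSFER, blanket `CorCM/FaceSylowTransfer*` HOME/INBOX.md l.23357, claim l.26753).  Theorems only; `Census/SylowTransferReflected.lean` (this
seat), the field transfer `CorCM/FaceGenerationTransfer.lean` and the INT2-GEN socket are used BY NAME; nothing asserted.  `Interfaces.lean` (C1),
every E term, B01, `Transposition/*`, `PortJoin/*`, `D2Bridge/*` untouched.  HONEST FRAMING: `HC_CM` is NOT proved, here or anywhere in the tree; this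
file produces no period and proves no face period for any field; §2 is CONDITIONAL on the face periods exactly as the earlier sockets.
T5: n/a-class (hypothesis binders: `[F:ℚ] = 8m`, `m` odd, an automorphism of order `m` that is central ∕ reflected — inhabited by every compositum
`K₈·L` of a Galois octic CM field `K₈` and a cyclic totally real field `L` of odd degree `m` (e.g. `K₈·ℚ(ζ₇)⁺`, `K₈·ℚ(ζ₉)⁺`, `K₈ = ℚ(ζ₁₅), ℚ(ζ₁₆), ℚ(ζ₂₀), ℚ(ζ₂₄)`,
a `D₄`- or `Q₈`-octic); resp. two Galois subfields of degrees `8` and `m`; checker: self, 2026-08-26).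
-/
import Summits.HodgeConjecture.CorCM.Census.SylowTransferReflected
import Summits.HodgeConjecture.CorCM.FaceSylowTransferEightPrimeAll
import HarnessLib

/-!
# Field level of the Sylow transfer, VII: degree `8m` with a reflected or central automorphism of order `m`; the octic composita

**`isLeast_card_faces_hgen_of_aut_reflected`**: a Galois CM field `F` of degree `8m` (`m` odd) with an automorphism `z₀` of order `m` all of whose
conjugates in `Aut(F)` are `z₀` or `z₀⁻¹` has EXACTLY `φ₂(F)` generating faces (σ₀, the degree and `z₀` only; `Census/SylowTransferReflected.lean`).
**`…_of_aut_central_odd`**: the same for a CENTRAL automorphism of order `m` (Galois group `P × C_m`, `P` any group of order `8`).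
**THE OCTIC COMPOSITA (`…_of_galois_octic_compositum`)**: `F` of degree `8m` (`m` odd) containing a Galois subfield `E` of degree `8` over which `F`
is cyclic and a Galois subfield `L` of degree `m` — i.e. `F = E·L` with `Gal(F/ℚ) = Gal(E/ℚ) × Gal(L/ℚ)`, e.g. a Galois octic CM field times a cyclic
totally real field of odd degree — has EXACTLY `φ₂(F)` generating faces: `Gal(F/E)` and `Gal(F/L)` are normal of coprime orders `m` and `8`, so they
commute elementwise and a generator of `Gal(F/E)` is central.  (Galois subfields are stated as «the fixing subgroup is normal», as in part VI.)
§2: the CONDITIONAL Hodge-conjecture readings through the INT2-GEN socket.  `HC_CM` is NOT proved.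

## References
* [Pohlmann1968] H. Pohlmann, Algebraic cycles on abelian varieties of complex multiplication type, Ann. of Math. 88 (1968), Thm 1.
* [Shimura1998] G. Shimura, Abelian Varieties with Complex Multiplication and Modular Functions, §6.2 Thm. 3, §8.1.
-/

noncomputable section

open CategoryTheory NumberField NumberField.ComplexEmbedding
open Literature.AlgebraicGeometry Literature.AlgebraicGeometry.Motives Literature.AlgebraicGeometry.HodgeTheory
open Literature.AlgebraicGeometry.ComplexMultiplication Literature.AlgebraicGeometry.Milne1999
open Literature.NumberTheory.Automorphic
open Literature.NumberTheory.Automorphic.PicardCM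
open Summit.HodgeConjecture.CorCM.Domination

namespace Summit.HodgeConjecture.CorCM.FaceSylowTransfer

open Summit.HodgeConjecture.CorCM.Prior.AllgGroup.RfwfAllgGroup
open Summit.HodgeConjecture.CorCM.Census.BlockParity
open Summit.HodgeConjecture.CorCM.Census.Coinvariant
open Summit.HodgeConjecture.CorCM.Census
open Summit.HodgeConjecture.CorCM.FaceCensus.OddSlice (galTOfAut galTOfAut_mul galTOfAut_conjAut)

section Field

variable {F : Type} [Field F] [NumberField F]

/-! ## §1 Exactly `φ₂(F)` generating faces -/

/-- **DEGREE `8m` (`m` ODD) WITH A REFLECTED ELEMENT OF ORDER `m` IN `GalT F` ⟹ EXACTLY `φ₂(F)` GENERATING FACES.** [folklore] -/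
theorem isLeast_card_faces_hgen_of_reflected [IsCMField F] [IsGalois ℚ F] {m : ℕ} (hm : Odd m)
    (hdeg : Module.finrank ℚ F = 8 * m) (z : GalT F) (hz : orderOf z = m)
    (hrefl : ∀ w : GalT F, w * z * w⁻¹ = z ∨ w * z * w⁻¹ = z⁻¹) (σ₀ : F →+* ℂ) :
    IsLeast {n : ℕ | ∃ 𝒮 : Finset (Face F), 𝒮.card = n ∧
      ∀ f : Face F, lefChar f.corner (fun _ => ({σ₀} : Finset (F →+* ℂ))) ∈ AddSubgroup.closure
        {a : Asym F | ∃ g ∈ (𝒮 : Set (Face F)), ∃ σ : F →+* ℂ, a = lefChar g.corner (fun _ => ({σ} : Finset (F →+* ℂ)))}}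
      (fibreTwo (conjT : GalT F) conjT_mul_self) := by
  refine FaceTransfer.isLeast_card_faces_hgen_of_intrinsic _ ?_ (fun S₀ hS₀ hS => ?_) σ₀
  · obtain ⟨S, hS, hcard, hgen⟩ := (SylowTransfer.isLeast_card_gfaces_generate_fibreTwo_of_reflected' conjT hm
      ((FaceCensus.card_galT (F := F)).trans hdeg) z hz hrefl conjT_mul_self conjT_ne_one FaceBasis.conjT_comm).1
    exact ⟨S, hS, hcard.le, hgen⟩
  · exact fibreTwo_le_card conjT conjT_mul_self FaceBasis.conjT_comm S₀ (Submodule.span ℤ (pairSet conjT)) le_rfl hS₀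
      (fun y hy => hS (gfaceSet_subset_hodgeSpan conjT conjT_mul_self hy))

/-- **… automorphism form**: `[F:ℚ] = 8m` (`m` odd) and `z₀ ∈ Aut(F)` of order `m` all of whose conjugates are `z₀` or `z₀⁻¹` (e.g. `Gal(F/ℚ)`
dihedral-over-`⟨z₀⟩`, dicyclic, `X_m`-, `D₄ × C_m`-, `Q₈ × C_m`-fields, every abelian group of order `8m`). [folklore] -/
theorem isLeast_card_faces_hgen_of_aut_reflected [IsCMField F] [IsGalois ℚ F] (σ₀ : F →+* ℂ) {m : ℕ} (hm : Odd m)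
    (hdeg : Module.finrank ℚ F = 8 * m) (z₀ : F ≃ₐ[ℚ] F) (hz : orderOf z₀ = m)
    (hrefl : ∀ w : F ≃ₐ[ℚ] F, w * z₀ * w⁻¹ = z₀ ∨ w * z₀ * w⁻¹ = z₀⁻¹) :
    IsLeast {n : ℕ | ∃ 𝒮 : Finset (Face F), 𝒮.card = n ∧
      ∀ f : Face F, lefChar f.corner (fun _ => ({σ₀} : Finset (F →+* ℂ))) ∈ AddSubgroup.closure
        {a : Asym F | ∃ g ∈ (𝒮 : Set (Face F)), ∃ σ : F →+* ℂ, a = lefChar g.corner (fun _ => ({σ} : Finset (F →+* ℂ)))}}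
      (fibreTwo (conjT : GalT F) conjT_mul_self) := by
  set e : (F ≃ₐ[ℚ] F) ≃* GalT F := MulEquiv.mk' (galTOfAut σ₀) (galTOfAut_mul σ₀) with he
  have hz' : orderOf (e z₀) = m := by rw [← hz]; exact orderOf_injective e.toMonoidHom e.injective z₀
  refine isLeast_card_faces_hgen_of_reflected hm hdeg (e z₀) hz' (fun w => ?_) σ₀
  obtain ⟨w₀, rfl⟩ := e.surjective w
  rcases hrefl w₀ with h | h
  · exact Or.inl (by rw [← map_mul, ← map_inv, ← map_mul, h])
  · exact Or.inr (by rw [← map_mul, ← map_inv, ← map_mul, h, map_inv])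

/-- **DEGREE `8m` (`m` ODD) WITH A CENTRAL AUTOMORPHISM OF ORDER `m` ⟹ EXACTLY `φ₂(F)` GENERATING FACES** — Galois group `P × C_m` for ANY of the five
groups `P` of order `8` (and, for `m = 1`, every Galois octic CM field). [folklore] -/
theorem isLeast_card_faces_hgen_of_aut_central_odd [IsCMField F] [IsGalois ℚ F] (σ₀ : F →+* ℂ) {m : ℕ} (hm : Odd m)
    (hdeg : Module.finrank ℚ F = 8 * m) (z₀ : F ≃ₐ[ℚ] F) (hz : orderOf z₀ = m) (hzc : ∀ w : F ≃ₐ[ℚ] F, w * z₀ = z₀ * w) :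
    IsLeast {n : ℕ | ∃ 𝒮 : Finset (Face F), 𝒮.card = n ∧
      ∀ f : Face F, lefChar f.corner (fun _ => ({σ₀} : Finset (F →+* ℂ))) ∈ AddSubgroup.closure
        {a : Asym F | ∃ g ∈ (𝒮 : Set (Face F)), ∃ σ : F →+* ℂ, a = lefChar g.corner (fun _ => ({σ} : Finset (F →+* ℂ)))}}
      (fibreTwo (conjT : GalT F) conjT_mul_self) :=
  isLeast_card_faces_hgen_of_aut_reflected σ₀ hm hdeg z₀ hz (SylowTransfer.conj_eq_or_of_central hzc)

/-- **Two normal subgroups of coprime orders commute elementwise** (`[a, b] ∈ N₁ ⊓ N₂ = ⊥`). [folklore] -/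
theorem mul_comm_of_normal_of_coprime {G : Type*} [Group G] [Finite G] (N₁ N₂ : Subgroup G) (h₁ : N₁.Normal) (h₂ : N₂.Normal)
    (hcop : Nat.Coprime (Nat.card N₁) (Nat.card N₂)) {a b : G} (ha : a ∈ N₁) (hb : b ∈ N₂) : a * b = b * a := by
  have hbot : N₁ ⊓ N₂ = ⊥ := (Subgroup.disjoint_of_coprime_natCard hcop).eq_bot
  have hcomm : a * b * a⁻¹ * b⁻¹ ∈ N₁ ⊓ N₂ := by
    refine Subgroup.mem_inf.mpr ⟨?_, ?_⟩
    · have h := h₁.conj_mem a⁻¹ (inv_mem ha) b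
      have : a * b * a⁻¹ * b⁻¹ = a * (b * a⁻¹ * b⁻¹) := by group
      rw [this]
      exact mul_mem ha h
    · have h := h₂.conj_mem b hb a
      have : a * b * a⁻¹ * b⁻¹ = (a * b * a⁻¹) * b⁻¹ := rfl
      rw [this]
      exact mul_mem h (inv_mem hb)
  rw [hbot, Subgroup.mem_bot] at hcomm
  have : a * b * a⁻¹ * b⁻¹ * (b * a) = b * a := by rw [hcomm, one_mul]
  rw [← this]
  group

/-- **THE OCTIC COMPOSITA.**  `F` Galois CM of degree `8m` (`m` odd) with a Galois subfield `E` of degree `8` over which `F` is cyclic and a Galois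
subfield `L` of degree `m` (so `F = E·L`, `Gal(F/ℚ) ≅ Gal(E/ℚ) × Gal(L/ℚ)` with `Gal(L/ℚ)` cyclic of odd order — every compositum of a Galois octic
CM field with a cyclic totally real field of odd degree) ⟹ **EXACTLY `φ₂(F)` GENERATING FACES.**  A generator of `Gal(F/E)` is central: `Gal(F/E)`,
`Gal(F/L)` are normal of coprime orders `m`, `8`. [folklore] -/
theorem isLeast_card_faces_hgen_of_galois_octic_compositum [IsCMField F] [IsGalois ℚ F] (σ₀ : F →+* ℂ) {m : ℕ} (hm : Odd m)
    (hdeg : Module.finrank ℚ F = 8 * m) (E : IntermediateField ℚ F) (hE : Module.finrank ℚ E = 8) (hEn : E.fixingSubgroup.Normal)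
    (hEc : IsCyclic E.fixingSubgroup) (L : IntermediateField ℚ F) (hL : Module.finrank ℚ L = m) (hLn : L.fixingSubgroup.Normal) :
    IsLeast {n : ℕ | ∃ 𝒮 : Finset (Face F), 𝒮.card = n ∧
      ∀ f : Face F, lefChar f.corner (fun _ => ({σ₀} : Finset (F →+* ℂ))) ∈ AddSubgroup.closure
        {a : Asym F | ∃ g ∈ (𝒮 : Set (Face F)), ∃ σ : F →+* ℂ, a = lefChar g.corner (fun _ => ({σ} : Finset (F →+* ℂ)))}}
      (fibreTwo (conjT : GalT F) conjT_mul_self) := by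
  have hm0 : 0 < m := hm.pos
  -- orders of the two fixing subgroups
  have hcardE : Nat.card E.fixingSubgroup = m := by
    have h2 := Module.finrank_mul_finrank ℚ E F
    rw [hE, hdeg] at h2
    rw [IsGalois.card_fixingSubgroup_eq_finrank E]
    exact Nat.eq_of_mul_eq_mul_left (by norm_num : 0 < 8) h2
  have hcardL : Nat.card L.fixingSubgroup = 8 := by
    have h2 := Module.finrank_mul_finrank ℚ L F
    rw [hL, hdeg, mul_comm 8 m] at h2
    rw [IsGalois.card_fixingSubgroup_eq_finrank L]
    exact Nat.eq_of_mul_eq_mul_left hm0 h2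
  have hcop : Nat.Coprime (Nat.card E.fixingSubgroup) (Nat.card L.fixingSubgroup) := by
    rw [hcardE, hcardL, show (8 : ℕ) = 2 ^ 3 by norm_num]
    exact Nat.Coprime.pow_right _ (Nat.coprime_two_right.mpr hm)
  -- a generator of `Gal(F/E)`
  obtain ⟨g, hg⟩ := IsCyclic.exists_generator (α := E.fixingSubgroup)
  have hordg : orderOf (g : F ≃ₐ[ℚ] F) = m := by
    rw [Subgroup.orderOf_coe, orderOf_eq_card_of_forall_mem_zpowers hg, hcardE]
  -- `Gal(F/E) · Gal(F/L) = Gal(F/ℚ)` as complements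
  have hcompl : Subgroup.IsComplement' E.fixingSubgroup L.fixingSubgroup := by
    refine Subgroup.isComplement'_of_coprime ?_ hcop
    rw [hcardE, hcardL, IsGalois.card_aut_eq_finrank, hdeg, mul_comm]
  -- the generator is central
  have hzc : ∀ w : F ≃ₐ[ℚ] F, w * (g : F ≃ₐ[ℚ] F) = (g : F ≃ₐ[ℚ] F) * w := by
    intro w
    obtain ⟨⟨a, b⟩, hab, -⟩ := hcompl.existsUnique w
    simp only at hab
    rw [← hab]
    have hb : (b : F ≃ₐ[ℚ] F) * g = g * b :=
      (mul_comm_of_normal_of_coprime E.fixingSubgroup L.fixingSubgroup hEn hLn hcop g.2 b.2).symm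
    have ha : (a : F ≃ₐ[ℚ] F) * g = g * a := by
      obtain ⟨k, hk⟩ := Subgroup.mem_zpowers_iff.mp (hg a)
      have hk' : (g : F ≃ₐ[ℚ] F) ^ k = a := by rw [← Subgroup.coe_zpow, hk]
      rw [← hk']
      exact (Commute.self_zpow (g : F ≃ₐ[ℚ] F) k).eq.symm
    rw [mul_assoc, hb, ← mul_assoc, ha, mul_assoc]
  exact isLeast_card_faces_hgen_of_aut_central_odd σ₀ hm hdeg g hordg hzc

/-- **DEGREE `24` WITH A GALOIS OCTIC SUBFIELD AND A GALOIS CUBIC SUBFIELD ⟹ EXACTLY `φ₂(F)` GENERATING FACES** (e.g. every `K₈·ℚ(ζ₇)⁺`, `K₈·ℚ(ζ₉)⁺`;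
`Gal(F/E)` of prime order is cyclic). [folklore] -/
theorem isLeast_card_faces_hgen_of_finrank_eq_twentyfour_of_compositum [IsCMField F] [IsGalois ℚ F] (σ₀ : F →+* ℂ)
    (hdeg : Module.finrank ℚ F = 24) (E : IntermediateField ℚ F) (hE : Module.finrank ℚ E = 8) (hEn : E.fixingSubgroup.Normal)
    (L : IntermediateField ℚ F) (hL : Module.finrank ℚ L = 3) (hLn : L.fixingSubgroup.Normal) :
    IsLeast {n : ℕ | ∃ 𝒮 : Finset (Face F), 𝒮.card = n ∧
      ∀ f : Face F, lefChar f.corner (fun _ => ({σ₀} : Finset (F →+* ℂ))) ∈ AddSubgroup.closure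
        {a : Asym F | ∃ g ∈ (𝒮 : Set (Face F)), ∃ σ : F →+* ℂ, a = lefChar g.corner (fun _ => ({σ} : Finset (F →+* ℂ)))}}
      (fibreTwo (conjT : GalT F) conjT_mul_self) := by
  haveI : Fact (Nat.Prime 3) := ⟨Nat.prime_three⟩
  have hcardE : Nat.card E.fixingSubgroup = 3 := by
    have h2 := Module.finrank_mul_finrank ℚ E F
    rw [hE, hdeg] at h2
    rw [IsGalois.card_fixingSubgroup_eq_finrank E]
    omega
  have hcyc : IsCyclic E.fixingSubgroup := isCyclic_of_prime_card (p := 3) hcardE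
  exact isLeast_card_faces_hgen_of_galois_octic_compositum σ₀ (m := 3) ⟨1, rfl⟩ (by rw [hdeg]) E hE hEn hcyc L hL hLn

end Field

/-! ## §2 The Hodge-conjecture readings through the INT2-GEN socket (conditional on the face periods) -/

/-- **HC for the slice of a Galois CM field of degree `8m` (`m` odd) with a central automorphism of order `m`, from `φ₂(K)` face periods**
(CONDITIONAL; `HC_CM` is NOT proved). [cite: Shimura1998, §6.2 Theorem 3 and §6.1 Corollary of Theorem 2 (pp. 41–43)] [cite: Pohlmann1968, Thm. 1]
[cite: Milne1999LefschetzClasses, Thm. 3.2 and Cor. 4.5] [cite: MumfordAV1970, §19 Thm. 1 and p. 169] -/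
theorem hodgeConjectureFor_of_aut_central_odd_of_exists_facePeriod (K : CMField) [hGal : IsGalois ℚ K] (σ₀ : (K : Type) →+* ℂ)
    {m : ℕ} (hm : Odd m) (hdeg : Module.finrank ℚ K = 8 * m) (z₀ : (K : Type) ≃ₐ[ℚ] (K : Type)) (hz : orderOf z₀ = m)
    (hzc : ∀ w : (K : Type) ≃ₐ[ℚ] (K : Type), w * z₀ = z₀ * w) :
    ∃ 𝒮 : Finset (Face K), 𝒮.card = fibreTwo (conjT : GalT K) conjT_mul_self ∧
      ((∀ f ∈ 𝒮, ∃ ι₁ : K →+* ℂ, f.Admissible ι₁ ∧ ∃ (V : HermSpace3 K ι₁) (σ : K →+* ℂ),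
        (Model.picardCMUniverse exists_isReal_hodgeModel_holds hodgePQ_independent_of_hodgeModel_holds
          BallQuotient.ballQuotientUniformised_holds cmAbelianVarietyRealised_holds).PeriodNV ι₁ V K f.psi σ) →
      ∀ {P B : AbelianVariety ℂ}, AbelianVariety.IsProductOf (fun B : AbelianVariety ℂ =>
        ∃ (E : Type) (_ : Field E) (_ : NumberField E) (_ : IsCMField E) (_ : E →+* (K : Type)) (Φ : CMType E)
          (ι : 𝓞 E →+* End B) (ϑ : E →+* Module.End ℂ (complexBetti B.X 1)),
          IsCMTypeRealisation Φ B ι ϑ) P →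
      AVDominatedBy B P → HodgeConjectureFor B.dim B.X) := by
  obtain ⟨⟨𝒮, hcard, hgen⟩, -⟩ := isLeast_card_faces_hgen_of_aut_central_odd (F := K) σ₀ hm hdeg z₀ hz hzc
  refine ⟨𝒮, hcard, fun h P B hP hB => ?_⟩
  have h6 : 6 ≤ Module.finrank ℚ K := by rw [hdeg]; have := hm.pos; omega
  exact hodgeConjectureFor_of_avDominatedBy_isProductOf_of_exists_facePeriod_on K h6 (𝒮 : Set (Face K)) σ₀ hgen
    (fun f hf => h f (Finset.mem_coe.mp hf)) hP hB

/-- **HC for the slice of a Galois CM field of degree `8m` (`m` odd) with a reflected automorphism of order `m`, from `φ₂(K)` face periods**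
(CONDITIONAL; `HC_CM` is NOT proved). [cite: Shimura1998, §6.2 Theorem 3 and §6.1 Corollary of Theorem 2 (pp. 41–43)] [cite: Pohlmann1968, Thm. 1]
[cite: Milne1999LefschetzClasses, Thm. 3.2 and Cor. 4.5] [cite: MumfordAV1970, §19 Thm. 1 and p. 169] -/
theorem hodgeConjectureFor_of_aut_reflected_of_exists_facePeriod (K : CMField) [hGal : IsGalois ℚ K] (σ₀ : (K : Type) →+* ℂ)
    {m : ℕ} (hm : Odd m) (hdeg : Module.finrank ℚ K = 8 * m) (z₀ : (K : Type) ≃ₐ[ℚ] (K : Type)) (hz : orderOf z₀ = m)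
    (hrefl : ∀ w : (K : Type) ≃ₐ[ℚ] (K : Type), w * z₀ * w⁻¹ = z₀ ∨ w * z₀ * w⁻¹ = z₀⁻¹) :
    ∃ 𝒮 : Finset (Face K), 𝒮.card = fibreTwo (conjT : GalT K) conjT_mul_self ∧
      ((∀ f ∈ 𝒮, ∃ ι₁ : K →+* ℂ, f.Admissible ι₁ ∧ ∃ (V : HermSpace3 K ι₁) (σ : K →+* ℂ),
        (Model.picardCMUniverse exists_isReal_hodgeModel_holds hodgePQ_independent_of_hodgeModel_holds
          BallQuotient.ballQuotientUniformised_holds cmAbelianVarietyRealised_holds).PeriodNV ι₁ V K f.psi σ) →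
      ∀ {P B : AbelianVariety ℂ}, AbelianVariety.IsProductOf (fun B : AbelianVariety ℂ =>
        ∃ (E : Type) (_ : Field E) (_ : NumberField E) (_ : IsCMField E) (_ : E →+* (K : Type)) (Φ : CMType E)
          (ι : 𝓞 E →+* End B) (ϑ : E →+* Module.End ℂ (complexBetti B.X 1)),
          IsCMTypeRealisation Φ B ι ϑ) P →
      AVDominatedBy B P → HodgeConjectureFor B.dim B.X) := by
  obtain ⟨⟨𝒮, hcard, hgen⟩, -⟩ := isLeast_card_faces_hgen_of_aut_reflected (F := K) σ₀ hm hdeg z₀ hz hrefl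
  refine ⟨𝒮, hcard, fun h P B hP hB => ?_⟩
  have h6 : 6 ≤ Module.finrank ℚ K := by rw [hdeg]; have := hm.pos; omega
  exact hodgeConjectureFor_of_avDominatedBy_isProductOf_of_exists_facePeriod_on K h6 (𝒮 : Set (Face K)) σ₀ hgen
    (fun f hf => h f (Finset.mem_coe.mp hf)) hP hB

/-- **HC for the slice of an OCTIC COMPOSITUM** (`[K:ℚ] = 8m`, `m` odd, Galois subfields of degrees `8` — with `K/E` cyclic — and `m`), from
`φ₂(K)` face periods (CONDITIONAL; `HC_CM` is NOT proved). [cite: Shimura1998, §6.2 Theorem 3 and §6.1 Corollary of Theorem 2 (pp. 41–43)]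
[cite: Pohlmann1968, Thm. 1] [cite: Milne1999LefschetzClasses, Thm. 3.2 and Cor. 4.5] [cite: MumfordAV1970, §19 Thm. 1 and p. 169] -/
theorem hodgeConjectureFor_of_galois_octic_compositum_of_exists_facePeriod (K : CMField) [hGal : IsGalois ℚ K] (σ₀ : (K : Type) →+* ℂ)
    {m : ℕ} (hm : Odd m) (hdeg : Module.finrank ℚ K = 8 * m) (E : IntermediateField ℚ (K : Type)) (hE : Module.finrank ℚ E = 8)
    (hEn : E.fixingSubgroup.Normal) (hEc : IsCyclic E.fixingSubgroup) (L : IntermediateField ℚ (K : Type)) (hL : Module.finrank ℚ L = m)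
    (hLn : L.fixingSubgroup.Normal) :
    ∃ 𝒮 : Finset (Face K), 𝒮.card = fibreTwo (conjT : GalT K) conjT_mul_self ∧
      ((∀ f ∈ 𝒮, ∃ ι₁ : K →+* ℂ, f.Admissible ι₁ ∧ ∃ (V : HermSpace3 K ι₁) (σ : K →+* ℂ),
        (Model.picardCMUniverse exists_isReal_hodgeModel_holds hodgePQ_independent_of_hodgeModel_holds
          BallQuotient.ballQuotientUniformised_holds cmAbelianVarietyRealised_holds).PeriodNV ι₁ V K f.psi σ) →
      ∀ {P B : AbelianVariety ℂ}, AbelianVariety.IsProductOf (fun B : AbelianVariety ℂ =>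
        ∃ (E : Type) (_ : Field E) (_ : NumberField E) (_ : IsCMField E) (_ : E →+* (K : Type)) (Φ : CMType E)
          (ι : 𝓞 E →+* End B) (ϑ : E →+* Module.End ℂ (complexBetti B.X 1)),
          IsCMTypeRealisation Φ B ι ϑ) P →
      AVDominatedBy B P → HodgeConjectureFor B.dim B.X) := by
  obtain ⟨⟨𝒮, hcard, hgen⟩, -⟩ := isLeast_card_faces_hgen_of_galois_octic_compositum (F := K) σ₀ hm hdeg E hE hEn hEc L hL hLn
  refine ⟨𝒮, hcard, fun h P B hP hB => ?_⟩
  have h6 : 6 ≤ Module.finrank ℚ K := by rw [hdeg]; have := hm.pos; omega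
  exact hodgeConjectureFor_of_avDominatedBy_isProductOf_of_exists_facePeriod_on K h6 (𝒮 : Set (Face K)) σ₀ hgen
    (fun f hf => h f (Finset.mem_coe.mp hf)) hP hB

end Summit.HodgeConjecture.CorCM.FaceSylowTransfer
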